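import Summits.MatrixMultiplication.OmegaCensus.STPP222CubeCyclic
import Summits.MatrixMultiplication.OmegaCensus.STPP222CubeExponent
import Summits.MatrixMultiplication.OmegaCensus.STPPSmallPatternWitnesses
import Summits.MatrixMultiplication.OmegaCensus.STPPSmallPatternT2Below24

/-!
# ω-census, small pattern `(1,2,2)^k` in cyclic groups: the hosts form a RAY — `(1,2,2)^k ⊆ ℤ/m` for EVERY `m ≥ 12 / 24 / 33 / 48` (`k = 2, 3, 4, 5`)

Cell `pub-omega`, ω construction census, seat pub-omega ENG2 (gen 32). HONEST FRAMING (verbatim): lottery ticket; floor =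
certified bounds/negative ranges.  Census STRUCTURE bookkeeping (column B5: `T2(H)` = max `k` with `(1,2,2)^k ⊆ H`, CKSU 2005
Def. 5.1, tree `IsSTPP`, `|Aᵢ| = 1`, `|Bᵢ| = |Cᵢ| = 2`); nothing here bears on `ω` (no small-pattern family certifies a bound of interest).

WHAT IS PROVED.  For each `k = 2, 3, 4, 5` an INTEGER witness — `Aᵢ = {0}` and `2k` integer pairs — satisfies Def. 5.1 in `ℤ`
(`stppCheck`, kernel) with every one of its `k³·2⁴` constraint expressions of absolute value `≤ M_k` (`stppExprBound`, kernel),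
`M_2 = 11`, `M_3 = 23`, `M_4 = 34`, `M_5 = 53`; by the transfer lemma `stppCheck_map_intCast_zmod` (`STPP222CubeCyclic.lean`: a vanishing
residue of an integer of absolute value `< m` is a vanishing integer) it is a `(1,2,2)^k` family of `ZMod m` for every `m > M_k`.
The finitely many moduli between the cyclic onset and `M_k` (`k = 3`: 24–23; `k = 4`: 33–34; `k = 5`: 48–53; none for `k = 2`) are
covered by a witness table (one `decide` over `Finset.Icc`).  Results: `exists_isSTPP_122pow2_zmod_of_le` (`m ≥ 12`), `…pow3…` (`m ≥ 24`),
`…pow4…` (`m ≥ 33`), `…pow5…` (`m ≥ 48`), and the transports `…_of_addOrderOf` (any abelian group with an element of that order).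
With the tree's kernel lower sides (`STPPSmallPatternT2Below24`: no `(1,2,2)²` in any abelian group of order `≤ 11`, no `(1,2,2)³` of
order `≤ 23`) the cyclic host sets at `k = 2, 3` are EXACTLY the rays `[12, ∞)`, `[24, ∞)` (`exists_isSTPP_122pow2_zmod_iff`,
`exists_isSTPP_122pow3_zmod_iff`).  At `k = 4, 5` the lower sides (`ℤ/28 … ℤ/32` carry no `(1,2,2)⁴`; `ℤ/36 … ℤ/47` no `(1,2,2)⁵`) are
engine statements of the census (×1/×2 listers; order `≤ 27` kernel in `STPPSmallPatternT2Below28`; orders `38 … 47` at `k = 5` are the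
cell's kit card GO #106) and are NOT claimed here.

HOW THE WITNESSES WERE OBTAINED (provenance only; the kernel re-checks everything): the seat's exact engine (t2dfs v3, 128-bit port)
listed the first `(1,2,2)^k` family of every `ℤ/m` for `m` from the onset to `≈ 2.3×` the onset (all found — the scan itself is the
"no gap" observation), each family was lifted to `ℤ` by choosing representatives role by role (only within-role differences enter
Def. 5.1) and the lift with the smallest expression bound kept; for `k = 2, 3` the bound `M_k + 1` IS the cyclic onset (`12`, `24`:
ONE integer family covers the whole ray; `M_3 = 23` from an exhaustive pass over all normal-form families of `ℤ/24` — t2dfs all-mode,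
10 716 families × units × window cuts); for `k = 4` the same exhaustive pass over `ℤ/33` (16 families), `ℤ/34` (32) and `ℤ/35` (680)
gives minimal bounds `38 / 39 / 34`, so `M_4 = 34` and the "integer onset" `35` lies two above the cyclic onset `33` — `ℤ/33` and `ℤ/34`
host only wrap-around families (ENGINE statement ×1, recorded for STRUCTURE B5, not claimed by the file); `k = 5`: `M_5 = 53` from the
first solutions of `ℤ/48 … ℤ/110` (best at `ℤ/54`), no minimality claimed.  STRUCTURE remark (census prose, not a claim of the file):
the cyclic `(1,2,2)^k` host set is upward closed although `ℤ/m ↪ ℤ/m'` only when `m ∣ m'` — the integer witness is the mechanism.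

References: H. Cohn, R. Kleinberg, B. Szegedy, C. Umans, *Group-theoretic algorithms for matrix multiplication*, FOCS 2005
(arXiv:math/0511460), Def. 5.1.  Seat pub-omega ENG2 (gen 32), 2026-08-28; engine + scan records HOME
`pub-omega-eng2-g32/work/rays/`.
-/

open Literature.Computability.AlgebraicComplexity Finset

namespace Summit.MatrixMultiplication.OmegaCensus

/-! ## 0. Packaging: integer lists, pair gaps, cardinalities -/

/-- The all-zero singleton `A`-role `Aᵢ = {0}` of a `(1,2,2)^k` configuration (resp. `C`-role of a `(2,1,1)^k` one), as integer lists. -/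
def zeroLists (k : ℕ) : Fin k → List ℤ := fun _ => [0]

/-- Boolean check that `N` integer pairs have distinct entries at distance `≤ G` (so they stay 2-element sets modulo every `m > G`). -/
def pairGapCheckN {N : ℕ} (P : Fin N → ℤ × ℤ) (G : ℕ) : Bool :=
  (List.finRange N).all fun i => decide ((P i).1 ≠ (P i).2 ∧ ((P i).2 - (P i).1).natAbs ≤ G)

/-- A zero singleton list reduces `mod m` to a finset of cardinality `1`. -/
theorem card_zeroLists_map (k m : ℕ) (i : Fin k) :
    (((zeroLists k i).map (Int.cast : ℤ → ZMod m)).toFinset).card = 1 := by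
  simp [zeroLists]

/-- If `pairGapCheckN P G` holds then, modulo any `m > G`, each pair list is a finset of cardinality `2`. -/
theorem card_of_pairGapCheckN {N : ℕ} {P : Fin N → ℤ × ℤ} {G : ℕ} (h : pairGapCheckN P G = true) {m : ℕ}
    (hm : G < m) (i : Fin N) : (((pairList (P i)).map (Int.cast : ℤ → ZMod m)).toFinset).card = 2 := by
  simp only [pairGapCheckN, List.all_eq_true, List.mem_finRange, decide_eq_true_eq, forall_const] at h
  obtain ⟨h1, h2⟩ := h i
  exact card_toFinset_map_pair h1 (by omega)

/-- Packaging for `(1,2,2)^k`: zero singletons, two pair roles accepted by `stppCheck` in `ZMod m`, gaps `< m` ⇒ the existential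
size-pattern statement. [cite: CohnKleinbergSzegedyUmans2005, Def. 5.1] -/
theorem exists_isSTPP_122_of_intLists {m k G : ℕ} {PB PC : Fin k → ℤ × ℤ}
    (hS : stppCheck (fun i => (zeroLists k i).map (Int.cast : ℤ → ZMod m))
      (fun i => (pairList (PB i)).map (Int.cast : ℤ → ZMod m)) (fun i => (pairList (PC i)).map (Int.cast : ℤ → ZMod m)) = true)
    (hB : pairGapCheckN PB G = true) (hC : pairGapCheckN PC G = true) (hm : G < m) :
    ∃ A B C : Fin k → Finset (ZMod m), IsSTPP A B C ∧ ∀ i, (A i).card = 1 ∧ (B i).card = 2 ∧ (C i).card = 2 :=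
  exists_isSTPP_of_lists_cards _ _ _ hS fun i =>
    ⟨card_zeroLists_map k m i, card_of_pairGapCheckN hB hm i, card_of_pairGapCheckN hC hm i⟩

/-! ## `k = 2`: `(1,2,2)² ⊆ ℤ/m` for every `m ≥ 12` -/

/-- `k = 2` integer witness, `B`-pairs (an integer lift of the engine's `ℤ/12` family, chosen for its expression bound `11`). -/
def int122K2B : Fin 2 → ℤ × ℤ := ![(4, 6), (0, 2)]

/-- `k = 2` integer witness, `C`-pairs. -/
def int122K2C : Fin 2 → ℤ × ℤ := ![(0, 1), (4, 5)]

/-- The `k = 2` integer witness (`Aᵢ = {0}`) satisfies CKSU Def. 5.1 in `ℤ` (kernel evaluation of `stppCheck`).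
[cite: CohnKleinbergSzegedyUmans2005, Def. 5.1] -/
theorem stppCheck_int122K2 :
    stppCheck (zeroLists 2) (fun i => pairList (int122K2B i)) (fun i => pairList (int122K2C i)) = true := by
  decide +kernel

/-- Every constraint expression of the `k = 2` integer witness has absolute value `≤ 11` (kernel), and its pairs have distinct
entries at distance `≤ 11`. -/
theorem stppExprBound_int122K2 :
    stppExprBound (zeroLists 2) (fun i => pairList (int122K2B i)) (fun i => pairList (int122K2C i)) 11 = true ∧
      pairGapCheckN int122K2B 11 = true ∧ pairGapCheckN int122K2C 11 = true := by
  refine ⟨?_, ?_, ?_⟩ <;> decide +kernel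

/-- `(1,2,2)² ⊆ ℤ/m` for every `m ≥ 12`: the integer witness reduced `mod m` (transfer lemma `stppCheck_map_intCast_zmod`).
[cite: CohnKleinbergSzegedyUmans2005, Def. 5.1] -/
theorem exists_isSTPP_122pow2_zmod_of_le12 (m : ℕ) (hm : 12 ≤ m) :
    ∃ A B C : Fin 2 → Finset (ZMod m), IsSTPP A B C ∧ ∀ i, (A i).card = 1 ∧ (B i).card = 2 ∧ (C i).card = 2 :=
  exists_isSTPP_122_of_intLists (stppCheck_map_intCast_zmod stppCheck_int122K2 stppExprBound_int122K2.1 (show 11 < m by omega))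
    stppExprBound_int122K2.2.1 stppExprBound_int122K2.2.2 (by omega)

/-- **`(1,2,2)² ⊆ ℤ/m` for every `m ≥ 12`** — here the integer witness alone reaches the cyclic onset `12`: ONE integer
family covers the whole ray. [cite: CohnKleinbergSzegedyUmans2005, Def. 5.1] -/
theorem exists_isSTPP_122pow2_zmod_of_le (m : ℕ) (hm : 12 ≤ m) :
    ∃ A B C : Fin 2 → Finset (ZMod m), IsSTPP A B C ∧ ∀ i, (A i).card = 1 ∧ (B i).card = 2 ∧ (C i).card = 2 :=
  exists_isSTPP_122pow2_zmod_of_le12 m hm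

/-- Transport: every abelian group with an element of additive order `≥ 12` (in particular every finite abelian group of exponent
`≥ 12`) admits `(1,2,2)²`. [cite: CohnKleinbergSzegedyUmans2005, Def. 5.1] -/
theorem exists_isSTPP_122pow2_of_addOrderOf {G : Type*} [AddCommGroup G] (g : G) (hg : 12 ≤ addOrderOf g) :
    ∃ A B C : Fin 2 → Finset G, IsSTPP A B C ∧ ∀ i, (A i).card = 1 ∧ (B i).card = 2 ∧ (C i).card = 2 :=
  exists_isSTPP_122_of_injective _ (zmod_lift_zmultiples_injective g) (exists_isSTPP_122pow2_zmod_of_le _ hg)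

/-! ## `k = 3`: `(1,2,2)³ ⊆ ℤ/m` for every `m ≥ 24` -/

/-- `k = 3` integer witness, `B`-pairs (an integer lift of the engine's `ℤ/25` family, chosen for its expression bound `23`). -/
def int122K3B : Fin 3 → ℤ × ℤ := ![(0, 2), (10, 20), (14, 18)]

/-- `k = 3` integer witness, `C`-pairs. -/
def int122K3C : Fin 3 → ℤ × ℤ := ![(0, 1), (4, 5), (6, 7)]

/-- The `k = 3` integer witness (`Aᵢ = {0}`) satisfies CKSU Def. 5.1 in `ℤ` (kernel evaluation of `stppCheck`).
[cite: CohnKleinbergSzegedyUmans2005, Def. 5.1] -/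
theorem stppCheck_int122K3 :
    stppCheck (zeroLists 3) (fun i => pairList (int122K3B i)) (fun i => pairList (int122K3C i)) = true := by
  decide +kernel

/-- Every constraint expression of the `k = 3` integer witness has absolute value `≤ 23` (kernel), and its pairs have distinct
entries at distance `≤ 23`. -/
theorem stppExprBound_int122K3 :
    stppExprBound (zeroLists 3) (fun i => pairList (int122K3B i)) (fun i => pairList (int122K3C i)) 23 = true ∧
      pairGapCheckN int122K3B 23 = true ∧ pairGapCheckN int122K3C 23 = true := by
  refine ⟨?_, ?_, ?_⟩ <;> decide +kernel

/-- `(1,2,2)³ ⊆ ℤ/m` for every `m ≥ 24`: the integer witness reduced `mod m` (transfer lemma `stppCheck_map_intCast_zmod`).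
[cite: CohnKleinbergSzegedyUmans2005, Def. 5.1] -/
theorem exists_isSTPP_122pow3_zmod_of_le24 (m : ℕ) (hm : 24 ≤ m) :
    ∃ A B C : Fin 3 → Finset (ZMod m), IsSTPP A B C ∧ ∀ i, (A i).card = 1 ∧ (B i).card = 2 ∧ (C i).card = 2 :=
  exists_isSTPP_122_of_intLists (stppCheck_map_intCast_zmod stppCheck_int122K3 stppExprBound_int122K3.1 (show 23 < m by omega))
    stppExprBound_int122K3.2.1 stppExprBound_int122K3.2.2 (by omega)

/-- **`(1,2,2)³ ⊆ ℤ/m` for every `m ≥ 24`** — here the integer witness alone reaches the cyclic onset `24`: ONE integer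
family covers the whole ray. [cite: CohnKleinbergSzegedyUmans2005, Def. 5.1] -/
theorem exists_isSTPP_122pow3_zmod_of_le (m : ℕ) (hm : 24 ≤ m) :
    ∃ A B C : Fin 3 → Finset (ZMod m), IsSTPP A B C ∧ ∀ i, (A i).card = 1 ∧ (B i).card = 2 ∧ (C i).card = 2 :=
  exists_isSTPP_122pow3_zmod_of_le24 m hm

/-- Transport: every abelian group with an element of additive order `≥ 24` (in particular every finite abelian group of exponent
`≥ 24`) admits `(1,2,2)³`. [cite: CohnKleinbergSzegedyUmans2005, Def. 5.1] -/
theorem exists_isSTPP_122pow3_of_addOrderOf {G : Type*} [AddCommGroup G] (g : G) (hg : 24 ≤ addOrderOf g) :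
    ∃ A B C : Fin 3 → Finset G, IsSTPP A B C ∧ ∀ i, (A i).card = 1 ∧ (B i).card = 2 ∧ (C i).card = 2 :=
  exists_isSTPP_122_of_injective _ (zmod_lift_zmultiples_injective g) (exists_isSTPP_122pow3_zmod_of_le _ hg)

/-! ## `k = 4`: `(1,2,2)⁴ ⊆ ℤ/m` for every `m ≥ 33` -/

/-- `k = 4` integer witness, `B`-pairs (an integer lift of the engine's `ℤ/35` family, chosen for its expression bound `34`). -/
def int122K4B : Fin 4 → ℤ × ℤ := ![(9, 13), (7, 17), (1, 3), (0, 2)]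

/-- `k = 4` integer witness, `C`-pairs. -/
def int122K4C : Fin 4 → ℤ × ℤ := ![(0, 1), (2, 3), (7, 18), (10, 14)]

/-- The `k = 4` integer witness (`Aᵢ = {0}`) satisfies CKSU Def. 5.1 in `ℤ` (kernel evaluation of `stppCheck`).
[cite: CohnKleinbergSzegedyUmans2005, Def. 5.1] -/
theorem stppCheck_int122K4 :
    stppCheck (zeroLists 4) (fun i => pairList (int122K4B i)) (fun i => pairList (int122K4C i)) = true := by
  decide +kernel

/-- Every constraint expression of the `k = 4` integer witness has absolute value `≤ 34` (kernel), and its pairs have distinct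
entries at distance `≤ 34`. -/
theorem stppExprBound_int122K4 :
    stppExprBound (zeroLists 4) (fun i => pairList (int122K4B i)) (fun i => pairList (int122K4C i)) 34 = true ∧
      pairGapCheckN int122K4B 34 = true ∧ pairGapCheckN int122K4C 34 = true := by
  refine ⟨?_, ?_, ?_⟩ <;> decide +kernel

/-- `(1,2,2)⁴ ⊆ ℤ/m` for every `m ≥ 35`: the integer witness reduced `mod m` (transfer lemma `stppCheck_map_intCast_zmod`).
[cite: CohnKleinbergSzegedyUmans2005, Def. 5.1] -/
theorem exists_isSTPP_122pow4_zmod_of_le35 (m : ℕ) (hm : 35 ≤ m) :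
    ∃ A B C : Fin 4 → Finset (ZMod m), IsSTPP A B C ∧ ∀ i, (A i).card = 1 ∧ (B i).card = 2 ∧ (C i).card = 2 :=
  exists_isSTPP_122_of_intLists (stppCheck_map_intCast_zmod stppCheck_int122K4 stppExprBound_int122K4.1 (show 34 < m by omega))
    stppExprBound_int122K4.2.1 stppExprBound_int122K4.2.2 (by omega)

/-- Witness table (`B`-pairs) for the moduli `33 ≤ m ≤ 34` below the integer witness's reach: the engine's first solution in
`ℤ/m` (entries in `[0, m)`, read `mod m`). -/
def cyc122K4B : ℕ → Fin 4 → ℤ × ℤ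
  | 33 => ![(0, 3), (17, 29), (14, 30), (21, 31)]
  | 34 => ![(0, 2), (7, 31), (10, 13), (14, 32)]
  | _ => ![(0, 0), (0, 0), (0, 0), (0, 0)]

/-- Witness table (`C`-pairs) for `33 ≤ m ≤ 34`. -/
def cyc122K4C : ℕ → Fin 4 → ℤ × ℤ
  | 33 => ![(0, 1), (5, 10), (8, 20), (13, 16)]
  | 34 => ![(0, 1), (4, 16), (18, 25), (24, 27)]
  | _ => ![(0, 0), (0, 0), (0, 0), (0, 0)]

/-- For each `m` with `33 ≤ m ≤ 34` the tabulated family passes `stppCheck` in `ZMod m` and its pairs have distinct entries less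
than `m` apart (kernel evaluation, 2 moduli). [cite: CohnKleinbergSzegedyUmans2005, Def. 5.1] -/
theorem stppCheck_cyc122K4 : ∀ m ∈ Finset.Icc 33 34,
    stppCheck (fun i => (zeroLists 4 i).map (Int.cast : ℤ → ZMod m)) (fun i => (pairList (cyc122K4B m i)).map (Int.cast : ℤ → ZMod m))
      (fun i => (pairList (cyc122K4C m i)).map (Int.cast : ℤ → ZMod m)) = true ∧
    pairGapCheckN (cyc122K4B m) (m - 1) = true ∧ pairGapCheckN (cyc122K4C m) (m - 1) = true := by
  decide +kernel

/-- **`(1,2,2)⁴ ⊆ ℤ/m` for every `m ≥ 33`** (the cyclic onset; `33 … 34` by the table, `m ≥ 35` by the integer witness).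
[cite: CohnKleinbergSzegedyUmans2005, Def. 5.1] -/
theorem exists_isSTPP_122pow4_zmod_of_le (m : ℕ) (hm : 33 ≤ m) :
    ∃ A B C : Fin 4 → Finset (ZMod m), IsSTPP A B C ∧ ∀ i, (A i).card = 1 ∧ (B i).card = 2 ∧ (C i).card = 2 := by
  by_cases h : 35 ≤ m
  · exact exists_isSTPP_122pow4_zmod_of_le35 m h
  · have hmem : m ∈ Finset.Icc 33 34 := by rw [Finset.mem_Icc]; omega
    obtain ⟨hS, hB, hC⟩ := stppCheck_cyc122K4 m hmem
    exact exists_isSTPP_122_of_intLists hS hB hC (by omega)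

/-- Transport: every abelian group with an element of additive order `≥ 33` (in particular every finite abelian group of exponent
`≥ 33`) admits `(1,2,2)⁴`. [cite: CohnKleinbergSzegedyUmans2005, Def. 5.1] -/
theorem exists_isSTPP_122pow4_of_addOrderOf {G : Type*} [AddCommGroup G] (g : G) (hg : 33 ≤ addOrderOf g) :
    ∃ A B C : Fin 4 → Finset G, IsSTPP A B C ∧ ∀ i, (A i).card = 1 ∧ (B i).card = 2 ∧ (C i).card = 2 :=
  exists_isSTPP_122_of_injective _ (zmod_lift_zmultiples_injective g) (exists_isSTPP_122pow4_zmod_of_le _ hg)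

/-! ## `k = 5`: `(1,2,2)⁵ ⊆ ℤ/m` for every `m ≥ 48` -/

/-- `k = 5` integer witness, `B`-pairs (an integer lift of the engine's `ℤ/54` family, chosen for its expression bound `53`). -/
def int122K5B : Fin 5 → ℤ × ℤ := ![(30, 32), (38, 40), (0, 6), (18, 22), (14, 28)]

/-- `k = 5` integer witness, `C`-pairs. -/
def int122K5C : Fin 5 → ℤ × ℤ := ![(0, 1), (4, 5), (12, 13), (14, 15), (16, 17)]

/-- The `k = 5` integer witness (`Aᵢ = {0}`) satisfies CKSU Def. 5.1 in `ℤ` (kernel evaluation of `stppCheck`).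
[cite: CohnKleinbergSzegedyUmans2005, Def. 5.1] -/
theorem stppCheck_int122K5 :
    stppCheck (zeroLists 5) (fun i => pairList (int122K5B i)) (fun i => pairList (int122K5C i)) = true := by
  decide +kernel

/-- Every constraint expression of the `k = 5` integer witness has absolute value `≤ 53` (kernel), and its pairs have distinct
entries at distance `≤ 53`. -/
theorem stppExprBound_int122K5 :
    stppExprBound (zeroLists 5) (fun i => pairList (int122K5B i)) (fun i => pairList (int122K5C i)) 53 = true ∧
      pairGapCheckN int122K5B 53 = true ∧ pairGapCheckN int122K5C 53 = true := by
  refine ⟨?_, ?_, ?_⟩ <;> decide +kernel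

/-- `(1,2,2)⁵ ⊆ ℤ/m` for every `m ≥ 54`: the integer witness reduced `mod m` (transfer lemma `stppCheck_map_intCast_zmod`).
[cite: CohnKleinbergSzegedyUmans2005, Def. 5.1] -/
theorem exists_isSTPP_122pow5_zmod_of_le54 (m : ℕ) (hm : 54 ≤ m) :
    ∃ A B C : Fin 5 → Finset (ZMod m), IsSTPP A B C ∧ ∀ i, (A i).card = 1 ∧ (B i).card = 2 ∧ (C i).card = 2 :=
  exists_isSTPP_122_of_intLists (stppCheck_map_intCast_zmod stppCheck_int122K5 stppExprBound_int122K5.1 (show 53 < m by omega))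
    stppExprBound_int122K5.2.1 stppExprBound_int122K5.2.2 (by omega)

/-- Witness table (`B`-pairs) for the moduli `48 ≤ m ≤ 53` below the integer witness's reach: the engine's first solution in
`ℤ/m` (entries in `[0, m)`, read `mod m`). -/
def cyc122K5B : ℕ → Fin 5 → ℤ × ℤ
  | 48 => ![(0, 2), (8, 10), (28, 30), (44, 46), (40, 42)]
  | 49 => ![(0, 2), (8, 10), (29, 31), (45, 47), (41, 43)]
  | 50 => ![(0, 2), (8, 10), (29, 31), (46, 48), (41, 43)]
  | 51 => ![(0, 2), (8, 10), (29, 31), (47, 49), (42, 43)]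
  | 52 => ![(0, 2), (8, 10), (26, 40), (30, 38), (22, 34)]
  | 53 => ![(0, 2), (8, 10), (30, 32), (47, 49), (43, 44)]
  | _ => ![(0, 0), (0, 0), (0, 0), (0, 0), (0, 0)]

/-- Witness table (`C`-pairs) for `48 ≤ m ≤ 53`. -/
def cyc122K5C : ℕ → Fin 5 → ℤ × ℤ
  | 48 => ![(0, 1), (4, 5), (12, 16), (13, 33), (20, 21)]
  | 49 => ![(0, 1), (4, 5), (12, 16), (13, 33), (20, 21)]
  | 50 => ![(0, 1), (4, 5), (12, 16), (13, 34), (20, 21)]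
  | 51 => ![(0, 1), (4, 5), (12, 16), (13, 35), (20, 22)]
  | 52 => ![(0, 1), (4, 5), (12, 13), (14, 15), (42, 43)]
  | 53 => ![(0, 1), (4, 5), (12, 16), (13, 36), (20, 22)]
  | _ => ![(0, 0), (0, 0), (0, 0), (0, 0), (0, 0)]

/-- For each `m` with `48 ≤ m ≤ 53` the tabulated family passes `stppCheck` in `ZMod m` and its pairs have distinct entries less
than `m` apart (kernel evaluation, 6 moduli). [cite: CohnKleinbergSzegedyUmans2005, Def. 5.1] -/
theorem stppCheck_cyc122K5 : ∀ m ∈ Finset.Icc 48 53,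
    stppCheck (fun i => (zeroLists 5 i).map (Int.cast : ℤ → ZMod m)) (fun i => (pairList (cyc122K5B m i)).map (Int.cast : ℤ → ZMod m))
      (fun i => (pairList (cyc122K5C m i)).map (Int.cast : ℤ → ZMod m)) = true ∧
    pairGapCheckN (cyc122K5B m) (m - 1) = true ∧ pairGapCheckN (cyc122K5C m) (m - 1) = true := by
  decide +kernel

/-- **`(1,2,2)⁵ ⊆ ℤ/m` for every `m ≥ 48`** (the cyclic onset; `48 … 53` by the table, `m ≥ 54` by the integer witness).
[cite: CohnKleinbergSzegedyUmans2005, Def. 5.1] -/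
theorem exists_isSTPP_122pow5_zmod_of_le (m : ℕ) (hm : 48 ≤ m) :
    ∃ A B C : Fin 5 → Finset (ZMod m), IsSTPP A B C ∧ ∀ i, (A i).card = 1 ∧ (B i).card = 2 ∧ (C i).card = 2 := by
  by_cases h : 54 ≤ m
  · exact exists_isSTPP_122pow5_zmod_of_le54 m h
  · have hmem : m ∈ Finset.Icc 48 53 := by rw [Finset.mem_Icc]; omega
    obtain ⟨hS, hB, hC⟩ := stppCheck_cyc122K5 m hmem
    exact exists_isSTPP_122_of_intLists hS hB hC (by omega)

/-- Transport: every abelian group with an element of additive order `≥ 48` (in particular every finite abelian group of exponent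
`≥ 48`) admits `(1,2,2)⁵`. [cite: CohnKleinbergSzegedyUmans2005, Def. 5.1] -/
theorem exists_isSTPP_122pow5_of_addOrderOf {G : Type*} [AddCommGroup G] (g : G) (hg : 48 ≤ addOrderOf g) :
    ∃ A B C : Fin 5 → Finset G, IsSTPP A B C ∧ ∀ i, (A i).card = 1 ∧ (B i).card = 2 ∧ (C i).card = 2 :=
  exists_isSTPP_122_of_injective _ (zmod_lift_zmultiples_injective g) (exists_isSTPP_122pow5_zmod_of_le _ hg)

/-! ## Exact rays at `k = 2, 3` (with the tree's kernel lower sides) -/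

/-- **The cyclic hosts of `(1,2,2)²` are exactly `m ≥ 12`** (`m ≥ 1`; `ZMod 0 = ℤ` hosts everything and is excluded).
[cite: CohnKleinbergSzegedyUmans2005, Def. 5.1] -/
theorem exists_isSTPP_122pow2_zmod_iff (m : ℕ) [NeZero m] :
    (∃ A B C : Fin 2 → Finset (ZMod m), IsSTPP A B C ∧ ∀ i, (A i).card = 1 ∧ (B i).card = 2 ∧ (C i).card = 2) ↔ 12 ≤ m := by
  refine ⟨fun h => ?_, exists_isSTPP_122pow2_zmod_of_le m⟩
  by_contra hlt
  exact not_exists_isSTPP_122pow2_of_card_le (G := ZMod m) (by rw [Nat.card_zmod]; omega) h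

/-- **The cyclic hosts of `(1,2,2)³` are exactly `m ≥ 24`** (`m ≥ 1`). [cite: CohnKleinbergSzegedyUmans2005, Def. 5.1] -/
theorem exists_isSTPP_122pow3_zmod_iff (m : ℕ) [NeZero m] :
    (∃ A B C : Fin 3 → Finset (ZMod m), IsSTPP A B C ∧ ∀ i, (A i).card = 1 ∧ (B i).card = 2 ∧ (C i).card = 2) ↔ 24 ≤ m := by
  refine ⟨fun h => ?_, exists_isSTPP_122pow3_zmod_of_le m⟩
  by_contra hlt
  exact not_exists_isSTPP_122pow3_of_card_le (G := ZMod m) (by rw [Nat.card_zmod]; omega) h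

end Summit.MatrixMultiplication.OmegaCensus
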